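import Mathlib
import Summits.ValiantsHypothesis.ValiantsHypothesis.Theorems.RigidityForcesSymmetryRankRigidMinimalReprLaplaceFiveSeparatedCaptureProlongation

/-!
# ValiantsHypothesis / RigidityForcesSymmetry — crux `LaplaceOptimalFive` (stmt-ValiantsHypothesis-24813), young-shadow K1:
# **THE PROLONGATION BOUND, next step**: `dim X ≤ 4 ⇒ dim prolong X ≤ 5` (Macaulay `h₂ ≤ 4 ⇒ h₃ ≤ 5`, by the slice argument)

Sequel of ✓ `…SeparatedCaptureProlongation.lean` (`prolong`, ★ `finrank_prolong_le_one/_two`, ★★ `_le_four`).  The same slice route one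
dimension up: for a symmetric configuration space `X` with `dim X ≤ 4`, `dim prolong X ≤ 5` — the case `h₂ ≤ 4 ⇒ h₃ ≤ 4^⟨2⟩ = 5` of
Macaulay's growth bound for inverse systems (F. S. Macaulay 1927; Bruns–Herzog Thm. 4.2.10 — CONTEXT only; sharp at `X = Sym²P ⊕ ℂq`
type spaces is NOT claimed here).  The one new ingredient is ★ `finrank_range_slice_le_three`: a space of SYMMETRIC matrices all of whose
rows lie in a PLANE `L` has dimension `≤ 3` (= `Sym² L`), proved without bases: a coordinate `r₀` not vanishing on `L` gives a row map into
`L` whose kernel consists of symmetric matrices with rows on the line `L ∩ {x r₀ = 0}`, i.e. multiples of one `λλᵀ`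
(✓ `mem_span_outer_of_rows`).  Then `ℓ := dim L_p ∈ {1, 2, ≥ 3}` gives `1 + 4`, `3 + 2`, `dim X + 1` respectively.
Use (critic of record val-idea-crit-3 g9, 10:29:49Z): with ✓ `finrank_le_prolong_of_disjoint`-type reductions, every consumer that needs
only `dim prolong X ≤ dim X + 1` now reaches `dim X ≤ 4`.

Honest framing.  A LEMMA (linear algebra of symmetric tensors); it closes nothing by itself.  K1 on `K₃ ⊔ K₂`, `CaptureIneqSym`, S2′,
`LaplaceOptimalFive` (OPEN · CONTESTED 72/120), `RankRigidMinimalRepr`, `VP ≠ VNP` are NOT proved.  No definitions, no `sorry`.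
-/

set_option linter.dupNamespace false
set_option autoImplicit false

namespace Summit.ValiantsHypothesis.ValiantsHypothesis.Theorems.RigidityForcesSymmetryRankRigidMinimalRepr

namespace LaplaceFiveSeparatedCapture

open Finset

/-! ### The next Macaulay step: `dim X ≤ 4 ⇒ dim prolong X ≤ 5` -/

/-- **Image of the slice map when the `p`-th rows of `X` span at most a PLANE**: dimension `≤ 3`.  A symmetric matrix with all rows
in a plane `L`: choose a coordinate `r₀` that does not vanish on `L`; the `r₀`-th row map sends the image into `L` (dimension `≤ 2`) and
its kernel consists of symmetric matrices with all rows in the LINE `L ∩ {x : x r₀ = 0}`, multiples of one `λ λᵀ`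
(✓ `mem_span_outer_of_rows`). [folklore] -/
theorem finrank_range_slice_le_three (X : Submodule ℂ (Fin 5 → Fin 5 → ℂ))
    (hXs : ∀ x ∈ X, ∀ q r : Fin 5, x q r = x r q) (p : Fin 5) (hL : Module.finrank ℂ (rowIm X p) ≤ 2) :
    Module.finrank ℂ (LinearMap.range ((sliceMap p).domRestrict (prolong X))) ≤ 3 := by
  classical
  set R := LinearMap.range ((sliceMap p).domRestrict (prolong X)) with hR
  set L := rowIm X p with hLdef
  -- members of `R` are symmetric with all rows in `L`
  have hRsym : ∀ M ∈ R, ∀ q r : Fin 5, M q r = M r q := fun M hM => hXs M (range_slice_le X p hM)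
  have hRrow : ∀ M ∈ R, ∀ q : Fin 5, M q ∈ L := by
    rintro M ⟨G, rfl⟩ q
    obtain ⟨h1, -, h3⟩ := G.2
    have e : ((G : Fin 5 → Fin 5 → Fin 5 → ℂ) p) q = fun r => (G : Fin 5 → Fin 5 → Fin 5 → ℂ) q p r := by
      funext r; exact h1 p q r
    show ((G : Fin 5 → Fin 5 → Fin 5 → ℂ) p) q ∈ L
    rw [e]
    exact ⟨(G : Fin 5 → Fin 5 → Fin 5 → ℂ) q, h3 q, rfl⟩
  by_cases hL0 : L = ⊥
  · -- all rows vanish: `R = ⊥`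
    have : R ≤ ⊥ := by
      intro M hM
      rw [Submodule.mem_bot]
      funext q
      have := hRrow M hM q
      rw [hL0, Submodule.mem_bot] at this
      exact this
    rw [le_bot_iff.mp this, finrank_bot]
    exact Nat.zero_le _
  -- a coordinate `r₀` not vanishing on `L`
  obtain ⟨y, hyL, hy0⟩ := (Submodule.ne_bot_iff L).mp hL0
  obtain ⟨r₀, hr₀⟩ := Function.ne_iff.mp hy0
  -- the `r₀`-th row map on `R`, with image in `L`
  let ρ : ↥R →ₗ[ℂ] (Fin 5 → ℂ) := (rowMap r₀).domRestrict R
  have hρL : LinearMap.range ρ ≤ L := by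
    rintro z ⟨M, rfl⟩
    exact hRrow M M.2 r₀
  have hrange : Module.finrank ℂ (LinearMap.range ρ) ≤ 2 := (Submodule.finrank_mono hρL).trans hL
  -- the kernel: symmetric matrices with rows in the line `L' = L ∩ ker (x ↦ x r₀)`
  -- `L'` is a proper subspace of `L` (it misses `y`), hence of dimension `≤ 1`
  let L' : Submodule ℂ (Fin 5 → ℂ) := L ⊓ LinearMap.ker (LinearMap.proj r₀)
  have hL'lt : L' < L := by
    refine lt_of_le_of_ne inf_le_left fun h => hr₀ ?_
    have : y ∈ L' := by rw [h]; exact hyL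
    simpa using this.2
  have hL'1 : Module.finrank ℂ L' ≤ 1 := by
    have := Submodule.finrank_lt_finrank_of_lt hL'lt
    omega
  obtain ⟨lam, hlam⟩ : ∃ lam : Fin 5 → ℂ, L' ≤ ℂ ∙ lam := by
    rcases Nat.lt_or_ge (Module.finrank ℂ L') 1 with h0 | h1
    · refine ⟨0, ?_⟩
      have hb : L' = ⊥ := Submodule.finrank_eq_zero.mp (by omega)
      rw [hb]; exact bot_le
    · obtain ⟨v, hv, hgen⟩ := finrank_eq_one_iff'.mp (le_antisymm hL'1 h1)
      refine ⟨(v : Fin 5 → ℂ), fun z hz => ?_⟩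
      obtain ⟨c, hc⟩ := hgen ⟨z, hz⟩
      rw [Submodule.mem_span_singleton]
      exact ⟨c, by simpa using congrArg Subtype.val hc⟩
  have hker : Module.finrank ℂ (LinearMap.ker ρ) ≤ 1 := by
    -- `(ker ρ).map R.subtype ≤ ℂ ∙ (λ λᵀ)`
    have hle : (LinearMap.ker ρ).map R.subtype ≤ (ℂ ∙ (fun q r => lam q * lam r) : Submodule ℂ (Fin 5 → Fin 5 → ℂ)) := by
      rintro M ⟨M', hM', rfl⟩
      have hrow0 : (M' : Fin 5 → Fin 5 → ℂ) r₀ = 0 := by simpa [ρ] using hM'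
      refine mem_span_outer_of_rows _ (hRsym _ M'.2) lam fun q => ?_
      -- row `q` lies in `L` and has `r₀`-entry `M q r₀ = M r₀ q = 0`
      have hq : (M' : Fin 5 → Fin 5 → ℂ) q ∈ L' := by
        refine ⟨hRrow _ M'.2 q, ?_⟩
        show (M' : Fin 5 → Fin 5 → ℂ) q r₀ = 0
        rw [hRsym _ M'.2 q r₀, hrow0, Pi.zero_apply]
      exact Submodule.mem_span_singleton.mp (hlam hq) |>.imp fun c hc => hc.symm
    have h1 : Module.finrank ℂ ((LinearMap.ker ρ).map R.subtype) ≤ 1 := by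
      refine (Submodule.finrank_mono hle).trans ?_
      by_cases h0 : (fun q r => lam q * lam r : Fin 5 → Fin 5 → ℂ) = 0
      · rw [h0, Submodule.span_zero_singleton, finrank_bot]; exact zero_le_one
      · exact (finrank_span_singleton h0).le
    rwa [Submodule.finrank_map_subtype_eq] at h1
  have hrn := LinearMap.finrank_range_add_finrank_ker ρ
  omega

/-- ★★ **`dim X ≤ 4 ⇒ dim prolong X ≤ 5`** (symmetric `X`): the case `h₂ ≤ 4 ⇒ h₃ ≤ 5` of Macaulay's bound, by the slice argument —
`ℓ = 1`: `1 + dim prolong K_p ≤ 1 + 4`; `ℓ = 2`: `3 + 2`; `ℓ = 3`: `4 + 1`; `ℓ = 4`: `4 + 0`. [folklore] -/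
theorem finrank_prolong_le_five (X : Submodule ℂ (Fin 5 → Fin 5 → ℂ))
    (hXs : ∀ x ∈ X, ∀ q r : Fin 5, x q r = x r q) (hX : Module.finrank ℂ X ≤ 4) :
    Module.finrank ℂ (prolong X) ≤ 5 := by
  by_cases h0 : X = ⊥
  · subst h0
    rw [prolong_bot, finrank_bot]
    exact Nat.zero_le _
  obtain ⟨p, hp⟩ := exists_finrank_rowIm_pos X h0
  have hrn := finrank_rowKer_add_finrank_rowIm X p
  have hstep := finrank_prolong_le_step X p
  have hKs : ∀ x ∈ rowKer X p, ∀ q r : Fin 5, x q r = x r q := fun x hx => hXs x (rowKer_le X p hx)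
  have hRX : Module.finrank ℂ (LinearMap.range ((sliceMap p).domRestrict (prolong X))) ≤ Module.finrank ℂ X :=
    Submodule.finrank_mono (range_slice_le X p)
  rcases Nat.lt_or_ge (Module.finrank ℂ (rowIm X p)) 2 with h1 | h2
  · -- `ℓ = 1`
    have hR := finrank_range_slice_le_one X hXs p (by omega)
    have hK := finrank_prolong_le_four (rowKer X p) hKs (by omega)
    omega
  rcases Nat.lt_or_ge (Module.finrank ℂ (rowIm X p)) 3 with h2' | h3
  · -- `ℓ = 2`
    have hR := finrank_range_slice_le_three X hXs p (by omega)
    have hK := finrank_prolong_le_two (rowKer X p) hKs (by omega)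
    omega
  · -- `ℓ ≥ 3`
    have hK := finrank_prolong_le_one (rowKer X p) hKs (by omega)
    omega

end LaplaceFiveSeparatedCapture

end Summit.ValiantsHypothesis.ValiantsHypothesis.Theorems.RigidityForcesSymmetryRankRigidMinimalRepr
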